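import Summits.ResolutionOfSingularities.ResolutionOfSingularities.Theorems.EquisingularLiftEquisingularLiftNatConeChart
import Summits.ResolutionOfSingularities.ResolutionOfSingularities.Theorems.EquisingularLiftCampaignW45bBlowupStalkDictionary
import Summits.ResolutionOfSingularities.ResolutionOfSingularities.Theorems.EquisingularLiftEquisingularLiftNatSectionStep
import Literature.AlgebraicGeometry.Resolution.BlowupSNC
import Literature.AlgebraicGeometry.Resolution.MarkedIdealsArithmetic
import Literature.AlgebraicGeometry.Resolution.StalkIdealLemmas
import HarnessLib

/-!
# [OURS · L1 W4.5(b)] T-CARRIER-Δ, scheme level (1/2): the Δ-centre `St_τ(K) ⊔ E` as an IDEAL SHEAF —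
# its support and image, and its STALKS at the points of the blow-up, read on the chart algebras

Support file of the crux chain w45b (cell `res-hironaka`, LADDER-RESOLUTION rung L, slot W4.5(b)), working crux
**EL♮ = `Theses.EquisingularLift.EquisingularLiftNat`** (stmt-ResolutionOfSingularities-20038), registered stub
`stub_elnat_three_isolated_nonabs`; target **T-CARRIER-Δ** of res-L1-w45b-lead-2 (TARGETS 2026-08-27 (2): «Δ-centres
inside a point-carrier as ideal sheaves: for a cone `K` through the section define `C := St_τ(K) ⊔ E`; (iii) its special
fibre is the plane curve `V(ḡ) ⊂ E`, (iv) its image is the section»), consumed by res-D-pv-013's T-Δ-ISO as the level-1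
step datum. OURS; NOT a statement of any manuscript; AI-written, weaker than expert review. Filed
`--supports stmt-ResolutionOfSingularities-20038 --as helper`.

THE Δ-CENTRE (no new definition): for a blow-up `τ : X' → X` along `J` (`IsBlowup τ J`) and an ideal sheaf `K` on `X`,
the ideal sheaf `strictTransformIdeal τ J K ⊔ J.comap τ` of `X'` (tree `MarkedIdeals.lean`: `strictTransformIdeal` =
`⨆ₙ (τ^*K : 𝓘(E)ⁿ)`, the schematic strict transform; `J.comap τ` = the exceptional divisor `E`) — the scheme-theoretic
intersection `St_τ(V(K)) ∩ E`.

* SUPPORT / IMAGE (any `τ`, `J`, `K`): `support_strictTransformIdeal_sup_comap_subset` (`supp C ⊆ τ⁻¹ supp J`),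
  `image_support_strictTransformIdeal_sup_comap_subset` (`τ '' supp C ⊆ supp J`). For the CARRIER case `J = ker s`,
  `s` a section of a separated `q : P → Spec O` over a DVR (`supp (ker s) = range s`, p167199):
  `image_support_carrierDelta_subset_range`, **`image_support_carrierDelta_subset_not_isGenericPoint`** (clause (d)
  «off-generic» of a HorizChainE1 step: `τ '' supp C` contains no generic point of an irreducible `Y` inside the special
  fibre as soon as `s(s₀)` is not one), its general-stage form `image_support_carrierDelta_subset_not_isGenericPoint'`
  (section of `σ ≫ q`), and the E1 LOCATOR `support_carrierDelta_inter_preimage_closedPoint_subset`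
  (`supp C ∩ (special fibre) ⊆ τ⁻¹ {s(s₀)}`: the special points of the Δ-centre all lie over the one point `s(s₀)`).
* STALKS (`exists_stalk_strictTransformIdeal_sup_comap`): at a point `x'` of `X'` with `τ x' ∈ supp J`, under the CONE
  HYPOTHESIS at the stalk `R = 𝒪_{X,τ x'}` — `J_{τ x'} = (c₁, …, c_r)` with `c` quasi-regular and `R/(c)` a domain,
  `K_{τ x'} = (Φ(c))` for a form `Φ ∈ R[T₁, …, T_r]` of degree `d` with `Φ̄ = Φ mod (c) ≠ 0` —, in the chart-algebra
  presentation `𝒪_{X',x'} ≅ R[I/c_j]_𝔔` of res-L1-w45b-stub-2's dictionary (`exists_blowupAlgebra_stalk_ringEquiv_of_eq`,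
  p506193): `E_{x'} = (c_j/1)`, `St_τ(K)_{x'} = (Φ(c/c_j))` (the ring core `iSup_colon_span_eval_eq_span_coneTransform_localization`
  of `…NatConeChart`, p508912), `C_{x'} = (Φ(c/c_j), c_j/1)`, and **`x' ∈ supp C ↔ Φ(c/c_j) ∈ 𝔔`** — claim (iii): the
  points of the Δ-centre over `τ x'` are the zeros of the dehomogenised reduced form `Φ̄_j` on the exceptional fibre.
  Also `mem_maximalIdeal_iff_of_stalk_ringEquiv` (`χ b ∈ 𝔪_{x'} ↔ b ∈ 𝔔` for such a presentation) and
  `isLocalization_stalk_of_ringEquiv` (the stalk IS a localisation of the chart algebra at `𝔔` along `χ`).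

The flatness over `O` and the regularity of `V(C)` (clauses (c), (b)) are the sequel `…NatCarrierDeltaFlatRegular`.

References: The Stacks Project, Tags 0804, 080C, 0BIQ; Görtz–Wedhorn I (2020), (13.19).
-/

set_option linter.dupNamespace false -- mandated namespace `Summit.<Summit>.<Problem>` of this single-conjunct summit
set_option linter.overlappingInstances false -- signatures carry `[IsDomain O] [IsDiscreteValuationRing O]`

noncomputable section

open CategoryTheory AlgebraicGeometry TopologicalSpace IsLocalRing
open Literature.AlgebraicGeometry.Resolution
open Summit.ResolutionOfSingularities.ResolutionOfSingularities.Cruxes.EquisingularLift.StrataSplit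

namespace Summit.ResolutionOfSingularities.ResolutionOfSingularities.Cruxes.EquisingularLiftNat.Sections

universe u

/-! ## Support and image of `St_τ(K) ⊔ E` -/

section Support

variable {X X' : Scheme.{u}} (τ : X' ⟶ X) (J K : X.IdealSheafData)

/-- `supp (St_τ(K) ⊔ E) ⊆ supp E = τ⁻¹ supp J`. [folklore] -/
theorem support_strictTransformIdeal_sup_comap_subset :
    ((strictTransformIdeal τ J K ⊔ J.comap τ).support : Set X') ⊆ τ ⁻¹' (J.support : Set X) := by
  intro x hx
  rw [Scheme.IdealSheafData.support_sup] at hx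
  have hx2 : x ∈ ((J.comap τ).support : Set X') := hx.2
  rwa [Scheme.IdealSheafData.support_comap, Closeds.coe_preimage] at hx2

/-- `τ '' supp (St_τ(K) ⊔ E) ⊆ supp J`: the Δ-centre lies over the old centre. [folklore] -/
theorem image_support_strictTransformIdeal_sup_comap_subset :
    τ '' ((strictTransformIdeal τ J K ⊔ J.comap τ).support : Set X') ⊆ (J.support : Set X) := by
  rintro _ ⟨x, hx, rfl⟩
  exact support_strictTransformIdeal_sup_comap_subset τ J K hx

end Support

/-! ## The carrier case `J = ker s`: image inside the section, off-generic clause, E1 locator -/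

section Carrier

variable (O : Type) [CommRing O] [IsDomain O] [IsDiscreteValuationRing O]

/-- For a section `s` of a separated `q : P → Spec O` (`O` a DVR) and a blow-up datum `τ : X₁ → P`, the Δ-centre
`St_τ(K) ⊔ (ker s)·𝒪_{X₁}` maps into the section: `τ '' supp C ⊆ range s` (`supp (ker s) = range s`, p167199).
[folklore] -/
theorem image_support_carrierDelta_subset_range {P X₁ : Scheme.{0}} (q : P ⟶ Spec (.of O)) [IsSeparated q]
    (s : Spec (.of O) ⟶ P) (hs : s ≫ q = 𝟙 _) (τ : X₁ ⟶ P) (K : P.IdealSheafData) :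
    τ '' ((strictTransformIdeal τ s.ker K ⊔ s.ker.comap τ).support : Set X₁) ⊆ Set.range s := by
  obtain ⟨-, -, -, hsupp⟩ := section_isClosedImmersion_and_isRegular_ker O P q s hs
  rw [← hsupp]
  exact image_support_strictTransformIdeal_sup_comap_subset τ s.ker K

/-- **Clause (d) «off-generic» for a Δ-centre.** With `Y ⊆ P` inside the special fibre and `s(s₀)` not a generic point
of `Y`, the image `τ '' supp C` of the Δ-centre contains no generic point of `Y` (it lies in `range s = {s(s₀), s(η)}`,
and `s(η)` is not in the special fibre). [folklore] -/
theorem image_support_carrierDelta_subset_not_isGenericPoint {P X₁ : Scheme.{0}} (q : P ⟶ Spec (.of O))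
    [IsSeparated q] (Y : Set P) (hY : Y ⊆ q ⁻¹' {IsLocalRing.closedPoint O}) (s : Spec (.of O) ⟶ P)
    (hs : s ≫ q = 𝟙 _) (hgen : ¬ IsGenericPoint (s (IsLocalRing.closedPoint O)) Y) (τ : X₁ ⟶ P)
    (K : P.IdealSheafData) :
    τ '' ((strictTransformIdeal τ s.ker K ⊔ s.ker.comap τ).support : Set X₁) ⊆ {x : P | ¬ IsGenericPoint x Y} := by
  -- adapted from `image_support_ker_subset_not_isGenericPoint` (…Theorems.EquisingularLiftEquisingularLiftNatSectionStep)
  have hcomp : ∀ t, q (s t) = t := fun t => by rw [← Scheme.Hom.comp_apply, hs]; rfl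
  intro y hy
  obtain ⟨t, rfl⟩ := image_support_carrierDelta_subset_range O q s hs τ K hy
  intro hgp
  have ht : t = IsLocalRing.closedPoint O := (hcomp t).symm.trans (hY hgp.mem)
  subst ht
  exact hgen hgp

/-- Clause (d) at a general stage: `σ : X → P`, `s` a section of `σ ≫ q`, `τ : X' → X`; then `(τ ≫ σ) '' supp C`
contains no generic point of `Y` as soon as `σ (s s₀)` is not one (tree `image_support_ker_subset_not_isGenericPoint`
for the section centre, and `τ '' supp C ⊆ supp (ker s)`). [folklore] -/
theorem image_support_carrierDelta_subset_not_isGenericPoint' {P X X' : Scheme.{0}} (σ : X ⟶ P)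
    (q : P ⟶ Spec (.of O)) [IsSeparated (σ ≫ q)] (Y : Set P) (hY : Y ⊆ q ⁻¹' {IsLocalRing.closedPoint O})
    (s : Spec (.of O) ⟶ X) (hs : s ≫ (σ ≫ q) = 𝟙 _)
    (hgen : ¬ IsGenericPoint (σ (s (IsLocalRing.closedPoint O))) Y) (τ : X' ⟶ X) (K : X.IdealSheafData) :
    (τ ≫ σ) '' ((strictTransformIdeal τ s.ker K ⊔ s.ker.comap τ).support : Set X') ⊆
      {x : P | ¬ IsGenericPoint x Y} := by
  rintro _ ⟨x', hx', rfl⟩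
  rw [Scheme.Hom.comp_apply]
  exact image_support_ker_subset_not_isGenericPoint O σ q Y hY s hs hgen
    ⟨τ x', support_strictTransformIdeal_sup_comap_subset τ s.ker K hx', rfl⟩

/-- **E1 locator.** The special points of the Δ-centre all lie over the single point `s(s₀)`:
`supp C ∩ (τ ≫ q)⁻¹ {s₀} ⊆ τ⁻¹ {s(s₀)}` (a point of `range s` in the special fibre is `s(s₀)`). So clause (e) «E1» of a
HorizChainE1 step is decided in the fibre `τ⁻¹(s(s₀))`, where `exists_stalk_strictTransformIdeal_sup_comap` describes
`supp C`. [folklore] -/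
theorem support_carrierDelta_inter_preimage_closedPoint_subset {P X₁ : Scheme.{0}} (q : P ⟶ Spec (.of O))
    [IsSeparated q] (s : Spec (.of O) ⟶ P) (hs : s ≫ q = 𝟙 _) (τ : X₁ ⟶ P) (K : P.IdealSheafData) :
    ((strictTransformIdeal τ s.ker K ⊔ s.ker.comap τ).support : Set X₁) ∩ (τ ≫ q) ⁻¹' {IsLocalRing.closedPoint O} ⊆
      τ ⁻¹' {s (IsLocalRing.closedPoint O)} := by
  have hcomp : ∀ t, q (s t) = t := fun t => by rw [← Scheme.Hom.comp_apply, hs]; rfl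
  rintro x' ⟨hx', hq⟩
  obtain ⟨t, ht⟩ := image_support_carrierDelta_subset_range O q s hs τ K ⟨x', hx', rfl⟩
  have hqt : q (τ x') = IsLocalRing.closedPoint O := by
    rw [← Scheme.Hom.comp_apply]; exact hq
  rw [← ht, hcomp] at hqt
  subst hqt
  exact ht.symm

end Carrier

/-! ## Stalks of `St_τ(K) ⊔ E` at the points of the blow-up, under the cone hypothesis -/

section Stalks

variable {X X' : Scheme.{u}} {τ : X' ⟶ X} {J : X.IdealSheafData}

/-- For a chart-algebra presentation `(χ, e)` of a stalk `𝒪_{X',x'} ≅ B_𝔔` (`χ : B → 𝒪_{X',x'}`, `e` a ring isomorphism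
with `e (χ b) = b/1`), membership in the maximal ideal is read on `𝔔`: `χ b ∈ 𝔪_{x'} ↔ b ∈ 𝔔`. [folklore] -/
theorem mem_maximalIdeal_iff_of_stalk_ringEquiv {B : Type u} [CommRing B] (𝔔 : PrimeSpectrum B) (x' : X')
    (χ : B →+* X'.presheaf.stalk x') (e : X'.presheaf.stalk x' ≃+* Localization.AtPrime 𝔔.asIdeal)
    (he : ∀ b, e (χ b) = algebraMap B (Localization.AtPrime 𝔔.asIdeal) b) (b : B) :
    χ b ∈ maximalIdeal (X'.presheaf.stalk x') ↔ b ∈ 𝔔.asIdeal := by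
  rw [IsLocalRing.mem_maximalIdeal, mem_nonunits_iff]
  have h1 : IsUnit (χ b) ↔ IsUnit (e (χ b)) := (MulEquiv.isUnit_map e.toMulEquiv).symm
  rw [h1, he, IsLocalization.AtPrime.isUnit_to_map_iff (Localization.AtPrime 𝔔.asIdeal) 𝔔.asIdeal b]
  change ¬ (b ∉ 𝔔.asIdeal) ↔ _
  rw [not_not]

/-- Such a presentation makes the stalk a LOCALISATION of the chart algebra at `𝔔` along `χ` (for the algebra
structure `χ.toAlgebra`). [folklore] -/
theorem isLocalization_stalk_of_ringEquiv {B : Type u} [CommRing B] (𝔔 : PrimeSpectrum B) (x' : X')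
    (χ : B →+* X'.presheaf.stalk x') (e : X'.presheaf.stalk x' ≃+* Localization.AtPrime 𝔔.asIdeal)
    (he : ∀ b, e (χ b) = algebraMap B (Localization.AtPrime 𝔔.asIdeal) b) :
    @IsLocalization.AtPrime _ _ (X'.presheaf.stalk x') _ χ.toAlgebra 𝔔.asIdeal _ := by
  have hfg : (e.symm.toRingHom.comp (algebraMap B (Localization.AtPrime 𝔔.asIdeal))) = χ :=
    RingHom.ext fun b => by
      rw [RingHom.comp_apply]
      change e.symm _ = _
      rw [RingEquiv.symm_apply_eq]
      exact (he b).symm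
  have h := (IsLocalization.isLocalization_iff_of_ringEquiv 𝔔.asIdeal.primeCompl e.symm).mp
    (inferInstanceAs (IsLocalization.AtPrime (Localization.AtPrime 𝔔.asIdeal) 𝔔.asIdeal))
  rw [hfg] at h
  exact h

set_option maxHeartbeats 400000 in -- the chart algebra `blowupAlgebra` is a subalgebra of a localisation: slow instance unification (cf. p506193)
/-- **THE STALKS OF THE Δ-CENTRE `St_τ(K) ⊔ E` UNDER THE CONE HYPOTHESIS.** Let `τ : X' → X` be a blow-up along `J`
(`IsBlowup`), `X'` locally Noetherian, `x' ∈ X'` with `τ x' ∈ supp J`. At the stalk `R = 𝒪_{X,τ x'}` suppose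
`J_{τ x'} = (c₁, …, c_r)` with `c` quasi-regular and `R/(c)` a domain (the centre is regular through `τ x'`, e.g. a
section of a smooth `P → Spec O`), and `K_{τ x'} = (Φ(c))` for a FORM `Φ ∈ R[T₁, …, T_r]` of degree `d` whose reduction
`Φ̄ ∈ (R/(c))[T]` is non-zero («`K` is the cone `V(Φ(c))` near `τ x'`»). Then for some chart index `j`, a prime `𝔔` of
the chart algebra `B = R[I/c_j]` over `𝔪_R`, a ring map `χ : B → 𝒪_{X',x'}` extending `τ^♯_{x'}` and a ring isomorphism
`e : 𝒪_{X',x'} ≅ B_𝔔` with `e ∘ χ = (· /1)` (res-L1-w45b-stub-2's dictionary, p506193):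
`E_{x'} = (χ (c_j/1))`, `St_τ(K)_{x'} = (χ Φ(c/c_j))`, `(St_τ(K) ⊔ E)_{x'} = (χ Φ(c/c_j)) + (χ (c_j/1))`, and
**`x' ∈ supp (St_τ(K) ⊔ E) ↔ Φ(c/c_j) ∈ 𝔔`** — on the exceptional fibre `𝔔 ∋ c_j/1`, and modulo `c_j/1` the element
`Φ(c/c_j)` is the dehomogenised reduced form `Φ̄_j` (`mk_coneTransform_eq`, p508912): the points of the Δ-centre are the
zeros of `Φ̄_j` on `E ∩ D₊(c_j) ≅ 𝔸^{r-1}_{V(J)}` — claim (iii) of T-CARRIER-Δ. [cite: StacksProject, Tag 0804] -/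
theorem exists_stalk_strictTransformIdeal_sup_comap [IsLocallyNoetherian X'] (hτ : IsBlowup τ J)
    (K : X.IdealSheafData) (x' : X') (hx' : τ x' ∈ (J.support : Set X)) {r : ℕ}
    (c : Fin r → X.presheaf.stalk (τ x')) (hcJ : Ideal.span (Set.range c) = stalkIdeal J (τ x'))
    (hc : IsQuasiRegular c) [IsDomain (X.presheaf.stalk (τ x') ⧸ Ideal.span (Set.range c))]
    {d : ℕ} (Φ : MvPolynomial (Fin r) (X.presheaf.stalk (τ x'))) (hΦd : Φ.IsHomogeneous d)
    (hΦ : MvPolynomial.map (Ideal.Quotient.mk (Ideal.span (Set.range c))) Φ ≠ 0)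
    (hK : stalkIdeal K (τ x') = Ideal.span {MvPolynomial.eval c Φ}) :
    ∃ (j : Fin r) (𝔔 : PrimeSpectrum (blowupAlgebra (Ideal.span (Set.range c)) (c j)))
      (χ : blowupAlgebra (Ideal.span (Set.range c)) (c j) →+* X'.presheaf.stalk x')
      (e : X'.presheaf.stalk x' ≃+* Localization.AtPrime 𝔔.asIdeal),
      (∀ a, χ (algebraMap _ _ a) = (τ.stalkMap x').hom a) ∧
      (∀ b, e (χ b) = algebraMap _ (Localization.AtPrime 𝔔.asIdeal) b) ∧
      𝔔.asIdeal.comap (algebraMap _ (blowupAlgebra (Ideal.span (Set.range c)) (c j))) =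
        maximalIdeal (X.presheaf.stalk (τ x')) ∧
      stalkIdeal (J.comap τ) x' =
        Ideal.span {χ (algebraMap _ (blowupAlgebra (Ideal.span (Set.range c)) (c j)) (c j))} ∧
      stalkIdeal (strictTransformIdeal τ J K) x' = Ideal.span {χ (MvPolynomial.aeval (blowupAlgebra.frac c j) Φ)} ∧
      stalkIdeal (strictTransformIdeal τ J K ⊔ J.comap τ) x' =
        Ideal.span {χ (MvPolynomial.aeval (blowupAlgebra.frac c j) Φ)} ⊔
          Ideal.span {χ (algebraMap _ (blowupAlgebra (Ideal.span (Set.range c)) (c j)) (c j))} ∧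
      (x' ∈ (strictTransformIdeal τ J K ⊔ J.comap τ).support ↔
        MvPolynomial.aeval (blowupAlgebra.frac c j) Φ ∈ 𝔔.asIdeal) := by
  obtain ⟨j, 𝔔, χ, e, hχ, he, h𝔔⟩ :=
    exists_blowupAlgebra_stalk_ringEquiv_of_eq hτ x' c (Ideal.span (Set.range c)) rfl hcJ
  letI := χ.toAlgebra
  haveI : IsLocalization.AtPrime (X'.presheaf.stalk x') 𝔔.asIdeal := isLocalization_stalk_of_ringEquiv 𝔔 x' χ e he
  have hstalkMap : (τ.stalkMap x').hom =
      χ.comp (algebraMap _ (blowupAlgebra (Ideal.span (Set.range c)) (c j))) :=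
    RingHom.ext fun a => (hχ a).symm
  -- the stalk of the exceptional ideal
  have hE : stalkIdeal (J.comap τ) x' =
      Ideal.span {χ (algebraMap _ (blowupAlgebra (Ideal.span (Set.range c)) (c j)) (c j))} := by
    rw [stalkIdeal_comap_eq_map_stalkMap, ← hcJ, hstalkMap, ← Ideal.map_map,
      map_blowupAlgebra_eq_span (Ideal.subset_span (Set.mem_range_self j)), Ideal.map_span, Set.image_singleton]
  -- the dehomogenised reduced form is non-zero on every chart
  have hΦj : MvPolynomial.map (Ideal.Quotient.mk (Ideal.span (Set.range c))) (dehomogenize j Φ) ≠ 0 := by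
    rw [map_dehomogenize]
    exact dehomogenize_ne_zero_of_isHomogeneous j (hΦd.map _) hΦ
  -- the stalk of the strict transform: the saturation, computed by the ring core in the localisation `𝒪_{X',x'}`
  have hSt : stalkIdeal (strictTransformIdeal τ J K) x' =
      Ideal.span {χ (MvPolynomial.aeval (blowupAlgebra.frac c j) Φ)} := by
    rw [stalkIdeal_strictTransformIdeal, hE, hK, Ideal.map_span, Set.image_singleton, hstalkMap]
    exact iSup_colon_span_eval_eq_span_coneTransform_localization c j hc hΦd hΦj 𝔔.asIdeal.primeCompl
      (X'.presheaf.stalk x')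
  have hC : stalkIdeal (strictTransformIdeal τ J K ⊔ J.comap τ) x' =
      Ideal.span {χ (MvPolynomial.aeval (blowupAlgebra.frac c j) Φ)} ⊔
        Ideal.span {χ (algebraMap _ (blowupAlgebra (Ideal.span (Set.range c)) (c j)) (c j))} := by
    rw [stalkIdeal_sup, hSt, hE]
  refine ⟨j, 𝔔, χ, e, hχ, he, h𝔔, hE, hSt, hC, ?_⟩
  -- support: `C_{x'} ⊆ 𝔪_{x'}` iff both generators are non-units iff `Φ(c/c_j) ∈ 𝔔` (`c_j/1 ∈ 𝔔` over `supp J`)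
  have ht𝔔 : algebraMap _ (blowupAlgebra (Ideal.span (Set.range c)) (c j)) (c j) ∈ 𝔔.asIdeal := by
    rw [← Ideal.mem_comap, h𝔔]
    have h := (mem_support_iff_stalkIdeal_le J (τ x')).mp hx'
    rw [← hcJ] at h
    exact h (Ideal.subset_span (Set.mem_range_self j))
  rw [mem_support_iff_stalkIdeal_le, hC, sup_le_iff, Ideal.span_singleton_le_iff_mem, Ideal.span_singleton_le_iff_mem,
    mem_maximalIdeal_iff_of_stalk_ringEquiv 𝔔 x' χ e he, mem_maximalIdeal_iff_of_stalk_ringEquiv 𝔔 x' χ e he]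
  exact ⟨fun h => h.1, fun h => ⟨h, ht𝔔⟩⟩

end Stalks

end Summit.ResolutionOfSingularities.ResolutionOfSingularities.Cruxes.EquisingularLiftNat.Sections

end
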